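import Summits.QuantumFields.YangMills.Theorems.UnitScaleTiltFluctuationComparisonRegPrGlobalSlackKernelLegPerRun
import HarnessLib

/-!
# `UnitScaleTiltFluctuationComparisonRegPrGlobalSlackKernelLegCfgFixedPoint` — THE LOOP-VARIABLE CLOSENESS ROW (R5) OF 3⁗χ FOR A NON-LINEAR BACKGROUND: [King1986] PROP. 3.9's
# REPLACEMENT STEP TYPED FOR A FIXED POINT (crux `FluctuationComparisonRegPrIntL`, stmt-QuantumFields-20520, skeleton v5kC, STUB 3⁗χ `stub_globalTwoRunSlackFamChi`; cell
# `pub/ym-inputs`, seat ym-inputs-p12 = INPUT-LIST I-11 row `CfgDistCauchyΦ`; count-neutral helper, registry untouched)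

WHY.  By name, the I-11 row `CfgDistCauchyΦ` (`…KernelLegWeights`, run `K+1`'s loop variables against run `K`'s) is supplied in the tree ONLY through `cfgDistCauchyΦ_of_ref`
(`…KernelLegRef`: a COHERENT reference functional `BR` + the per-run row `CfgRefΦ`) and `cfgRefΦ_of_own` (`…KernelLegRefOwn`: the own-indexed per-run row (R5) `CfgRefOwnΦ`),
and (R5) — «on run `K`'s window and listed domains, leg by leg, run `K`'s loop variable `B` is within `C_B·(1+d(c))·θ(n)·x²·(L^{−(1+j)})^a` of the reference `BR`» — is a row
of the door display `K1aLegRowsDisplayChiAt(Low)` that NO file supplies.  In [King1986] the background `A^{(k)}` of the U(1) model is LINEAR in the block field, so its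
two-cut-off closeness IS a propagator two-cut-off estimate (Prop. 3.8 (3.71), Prop. 3.9 (3.74), Prop. 3.10 (3.91)) applied to bounded data; the replacement step p.665 L9–14
«if we replace a propagator … the error is the same graph with a difference of propagators on one line».  For the NON-ABELIAN model the loop variables `B_k(c)` of (43)–(44)
are those of the constrained MINIMISER `U_k` ([Balaban1985UV3] p.266 L22–25: «determined by the variational problem considered in [7]»), which [Balaban1985Variational]
constructs by successive approximations — a FIXED POINT of a contraction on the small-field ball.  The replacement step for a fixed point is the a-posteriori contraction bound:
if `B = T B`, `T` is a `q`-contraction (`q < 1`) and the reference `BR` has defect `‖T BR − BR‖ ≤ δ`, then `‖B − BR‖ ≤ δ/(1 − q)` — and the defect of the LIMITING background in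
run `K`'s equation is `(T_K − T_∞)(BR)`, a two-cut-off difference of the defining maps at ONE bounded configuration (the I-11 propagator row of seat p10, applied to `BR`).
This file types exactly that, in the row's own legwise `(1 + d(c))`-weighted currency, with `T`, `T_∞`, `BR` FREE function variables and every hypothesis INLINE (no `def`):

* §1 **`norm_sub_le_weighted_of_isFixedPt`** — generic (finite index set, any normed group, any positive weights `w`): `T x = x`, `T` legwise `w`-weighted `q`-Lipschitz
  between `x` and `y` (`q < 1`), `‖T y c − y c‖ ≤ δ·w c` ⟹ `‖x c − y c‖ ≤ δ/(1−q)·w c` for every leg `c` (maximal weighted leg + one triangle inequality); `_pair` (defect split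
  through a reference equation); **`weighted_lipschitz_of_kernel`** + **`kernel_rowsum_one_add_le`** (the legwise weighted Lipschitz property from a kernel domination
  `‖T x c − T y c‖ ≤ Σ G(c,c′)‖x c′ − y c′‖` with a first-moment bound — print's (45) summation); §1b **`pdist_triangle`**, **`canonLegDist_le_add_pdist`** (the canonical leg
  distance is 1-Lipschitz in the sources) and **`canon_rowsum_one_add_le`** (display (C) at `canonLegDist F` from `Σ_{c′} G(c,c′)(1 + |c₋ − c′₋|_T) ≤ q`).
* §2 **`cfgRefOwnΦ_of_isFixedPt`** — (R5) `CfgRefOwnΦ D B BR dist b₀ p₀ a (C₀/(1−q))` from FOUR single-run displays, each indexed exactly like the rows of record: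
  (F) «`B` solves run `K`'s equation»: `T K (K−n) j Y (V↑) (B K (K−n) j Y (V↑)) = B K (K−n) j Y (V↑)` on the window / listed domains; (C) «`T` is a legwise `(1+d)`-weighted
  `q`-contraction on the (44)-ball», `q < 1` UNIFORM in `K, n, j, Y, V` (the `K`-uniformity IS the content); (S) both `B` and `BR` lie in the (44)-ball — the rows (R4)
  `CfgDistOwnΦ D B …` (already displayed) and `CfgDistOwnΦ D BR …`; (D) the defect row `‖T (BR) c − BR c‖ ≤ C₀·(1+d(c))·θ(n)·x²·(L^{−(1+j)})^a`.  Variant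
  **`cfgRefOwnΦ_of_isFixedPt_pair`**: (D) split as «`BR` solves the reference equation `T∞ (BR) = BR`» + «the two maps differ at `BR` by the budget» ([King1986]'s form).
* §3 the rows of record BY NAME: **`cfgRefΦ_of_isFixedPt`** (`cfgRefΦ_of_own`), **`cfgDistCauchyΦ_of_isFixedPt`** (`cfgDistCauchyΦ_of_ref`, constant `2C₀/(1−q)`).  The
  χ-instances at the canonical polymerisation and a free profile `p₁` are the sibling file `…KernelLegCfgFixedPointChi`.
WHAT THIS BUYS / DOES NOT.  (R5) — hence `CfgDistCauchyΦ` — for the minimiser's loop variables is REDUCED to (C) a `K`-uniform contraction rate of the successive-approximation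
map in the leg-weighted currency and (D) the two-cut-off defect of the limiting background in run `K`'s equation; both are statements about ONE run's package and ONE bounded
configuration.  It is NOT a discharge: `B` is pinned by (N) `NewLevelIsBirth` to the step data `𝔖.Bcfg`, whose construction at Bałaban's data (B0 of the NODE-O d = 3 bill)
is not in the tree; (C)/(D) for that `T` are located-UNPRINTED for the non-abelian d = 3 model (INPUT-LIST §5 item 3; [King1986] is U(1)).  Nothing of [Balaban1985UV3] /
[Balaban1985Variational] / [King1986] is asserted; no summit / rung / gap claim (YM₃ on T³ is rung R3, not the Clay problem).

References: C. King, CMP 102 (1986) 649–677 [King1986] (Prop. 3.8 (3.71) p.664, Prop. 3.9 (3.73)–(3.74) p.665 with p.665 L9–14, Prop. 3.10 (3.91) p.669); T. Bałaban,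
CMP 102 (1985) 255–275 [Balaban1985UV3] ((43)–(45) pp.266–267, p.266 L22–25); CMP 102 (1985) 277–309 [Balaban1985Variational] (Thm 1 (8) p.279); CMP 109 (1987) 249–301
[Balaban1987RG1] ((0.1) p.251).
-/

set_option autoImplicit false

noncomputable section

open scoped BigOperators
open Finset
open Literature.MathematicalPhysics.QuantumFieldTheory.Balaban1983to89
open Literature.MathematicalPhysics.QuantumFieldTheory.Balaban1983to89.T3ContinuumYM3Torus
open Literature.MathematicalPhysics.QuantumFieldTheory.Balaban1983to89.T3UnitScaleTilt
open Literature.MathematicalPhysics.QuantumFieldTheory.Balaban1983to89.T3LevelShift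
open Literature.MathematicalPhysics.QuantumFieldTheory.Balaban1983to89.T3AlphaInputsAC
open Literature.MathematicalPhysics.QuantumFieldTheory.Balaban1983to89.T3AlphaPolymerSocket
open Literature.MathematicalPhysics.QuantumFieldTheory.Balaban1983to89.T3AlphaInputsACTwoRun
open Literature.MathematicalPhysics.QuantumFieldTheory.Balaban1983to89.T3AlphaInputsACTwoRunLevel
open Literature.MathematicalPhysics.QuantumFieldTheory.Balaban1985CMP102
open Literature.MathematicalPhysics.QuantumFieldTheory.Balaban1985CMP102.Setting
open Summit.QuantumFields.Balaban3D.Carriers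
open Summit.QuantumFields.Balaban3D.Proofs.Primitives
open Summit.QuantumFields.Balaban3D.Proofs.GroupModelLieC (lieC)
open Summit.QuantumFields.YangMills.Theorems
open Summit.QuantumFields.YangMills.Theorems.GlobalSlackKernelMatching
open Summit.QuantumFields.YangMills.Theorems.GlobalSlackCanonicalPolymers

namespace Summit.QuantumFields.YangMills.Theorems.GlobalSlackKernelLeg

/-! ## §1 The a-posteriori contraction bound in a leg-weighted sup currency (generic) -/

section Aposteriori

variable {ι : Type*} [Fintype ι] {E : Type*} [NormedAddCommGroup E]

/-- **THE A-POSTERIORI CONTRACTION BOUND, LEG BY LEG WITH WEIGHTS** ([King1986] Prop. 3.9's replacement step for a fixed point instead of a linear background): on a finite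
index set with positive weights `w`, if `x` is a fixed point of `T`, `T` is `w`-weighted `q`-Lipschitz between `x` and `y` in the legwise sense
(`(∀ c, ‖x c − y c‖ ≤ M·w c) → ∀ c, ‖T x c − T y c‖ ≤ q·M·w c` for every `M ≥ 0`) with `q < 1`, and `y` has defect `‖T y c − y c‖ ≤ δ·w c`, then
`‖x c − y c‖ ≤ δ/(1 − q)·w c` for every `c` (take the leg maximising `‖x c − y c‖/w c` and one triangle inequality). [folklore] -/
theorem norm_sub_le_weighted_of_isFixedPt (w : ι → ℝ) (hw : ∀ c, 0 < w c) (T : (ι → E) → (ι → E)) {q δ : ℝ} (hq1 : q < 1)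
    (x y : ι → E) (hx : T x = x)
    (hlip : ∀ M : ℝ, 0 ≤ M → (∀ c, ‖x c - y c‖ ≤ M * w c) → ∀ c, ‖T x c - T y c‖ ≤ q * M * w c)
    (hdef : ∀ c, ‖T y c - y c‖ ≤ δ * w c) :
    ∀ c, ‖x c - y c‖ ≤ δ / (1 - q) * w c := by
  classical
  intro c₁
  haveI : Nonempty ι := ⟨c₁⟩
  -- the leg maximising the weighted difference
  obtain ⟨c₀, hc₀⟩ := Finite.exists_max fun c => ‖x c - y c‖ / w c
  set M : ℝ := ‖x c₀ - y c₀‖ / w c₀ with hM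
  have hM0 : 0 ≤ M := div_nonneg (norm_nonneg _) (hw c₀).le
  have hall : ∀ c, ‖x c - y c‖ ≤ M * w c := fun c => by
    have h := hc₀ c
    rwa [div_le_iff₀ (hw c)] at h
  -- at the maximising leg: `M·w c₀ = ‖x c₀ − y c₀‖ ≤ ‖T x c₀ − T y c₀‖ + ‖T y c₀ − y c₀‖ ≤ (q·M + δ)·w c₀`
  have hTx : T x c₀ = x c₀ := by rw [hx]
  have hsplit : x c₀ - y c₀ = (T x c₀ - T y c₀) + (T y c₀ - y c₀) := by rw [hTx]; abel
  have hkey : M * w c₀ ≤ (q * M + δ) * w c₀ := by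
    calc M * w c₀ = ‖x c₀ - y c₀‖ := by rw [hM, div_mul_cancel₀ _ (hw c₀).ne']
      _ = ‖(T x c₀ - T y c₀) + (T y c₀ - y c₀)‖ := by rw [← hsplit]
      _ ≤ ‖T x c₀ - T y c₀‖ + ‖T y c₀ - y c₀‖ := norm_add_le _ _
      _ ≤ q * M * w c₀ + δ * w c₀ := add_le_add (hlip M hM0 hall c₀) (hdef c₀)
      _ = (q * M + δ) * w c₀ := by ring
  have hMle : M ≤ q * M + δ := le_of_mul_le_mul_right hkey (hw c₀)
  have hM' : M ≤ δ / (1 - q) := by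
    rw [le_div_iff₀ (by linarith)]
    nlinarith
  calc ‖x c₁ - y c₁‖ ≤ M * w c₁ := hall c₁
    _ ≤ δ / (1 - q) * w c₁ := mul_le_mul_of_nonneg_right hM' (hw c₁).le

/-- **The same with the defect split [King1986]-style**: `y` solves a reference equation `S y = y` and the two maps differ at `y` by `δ` legwise (`‖T y c − S y c‖ ≤ δ·w c`).
[folklore] -/
theorem norm_sub_le_weighted_of_isFixedPt_pair (w : ι → ℝ) (hw : ∀ c, 0 < w c) (T S : (ι → E) → (ι → E)) {q δ : ℝ} (hq1 : q < 1)
    (x y : ι → E) (hx : T x = x) (hy : S y = y)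
    (hlip : ∀ M : ℝ, 0 ≤ M → (∀ c, ‖x c - y c‖ ≤ M * w c) → ∀ c, ‖T x c - T y c‖ ≤ q * M * w c)
    (hmap : ∀ c, ‖T y c - S y c‖ ≤ δ * w c) :
    ∀ c, ‖x c - y c‖ ≤ δ / (1 - q) * w c :=
  norm_sub_le_weighted_of_isFixedPt w hw T hq1 x y hx hlip fun c => by
    have h := hmap c
    rwa [hy] at h


/-- **LEGWISE WEIGHTED LIPSCHITZ FROM A KERNEL DOMINATION** (how display (C) below is met by an exponentially localised derivative, print's (45) summation): if
`‖T x c − T y c‖ ≤ Σ_{c′} G(c,c′)·‖x c′ − y c′‖` with `G ≥ 0` and the weighted row sums obey `Σ_{c′} G(c,c′)·w c′ ≤ q·w c`, then `T` is `w`-weighted `q`-Lipschitz between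
`x` and `y` in the legwise sense of `norm_sub_le_weighted_of_isFixedPt`. [cite: Balaban1985UV3, (45) p.267] -/
theorem weighted_lipschitz_of_kernel (w : ι → ℝ) (G : ι → ι → ℝ) (hG : ∀ c c', 0 ≤ G c c') {q : ℝ} (hsum : ∀ c, ∑ c', G c c' * w c' ≤ q * w c)
    (T : (ι → E) → (ι → E)) (x y : ι → E) (hker : ∀ c, ‖T x c - T y c‖ ≤ ∑ c', G c c' * ‖x c' - y c'‖) :
    ∀ M : ℝ, 0 ≤ M → (∀ c, ‖x c - y c‖ ≤ M * w c) → ∀ c, ‖T x c - T y c‖ ≤ q * M * w c := by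
  intro M hM hxy c
  calc ‖T x c - T y c‖ ≤ ∑ c', G c c' * ‖x c' - y c'‖ := hker c
    _ ≤ ∑ c', G c c' * (M * w c') := Finset.sum_le_sum fun c' _ => mul_le_mul_of_nonneg_left (hxy c') (hG c c')
    _ = M * ∑ c', G c c' * w c' := by rw [Finset.mul_sum]; exact Finset.sum_congr rfl fun c' _ => by ring
    _ ≤ M * (q * w c) := mul_le_mul_of_nonneg_left (hsum c) hM
    _ = q * M * w c := by ring

/-- **THE ROW-SUM CONDITION FOR THE WEIGHT `1 + d` FROM A `ρ`-MOMENT OF THE KERNEL** when the leg distance is `ρ`-Lipschitz (`d c′ ≤ d c + ρ(c,c′)`, `d, ρ, G ≥ 0`):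
`Σ_{c′} G(c,c′)(1 + ρ(c,c′)) ≤ q ⟹ Σ_{c′} G(c,c′)(1 + d c′) ≤ q·(1 + d c)` (since `1 + d c′ ≤ (1 + ρ(c,c′))(1 + d c)`). [cite: Balaban1985UV3, (45) p.267] -/
theorem kernel_rowsum_one_add_le (d : ι → ℝ) (hd : ∀ c, 0 ≤ d c) (ρ : ι → ι → ℝ) (hρ : ∀ c c', 0 ≤ ρ c c') (hdρ : ∀ c c', d c' ≤ d c + ρ c c')
    (G : ι → ι → ℝ) (hG : ∀ c c', 0 ≤ G c c') {q : ℝ} (hmom : ∀ c, ∑ c', G c c' * (1 + ρ c c') ≤ q) :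
    ∀ c, ∑ c', G c c' * (1 + d c') ≤ q * (1 + d c) := by
  intro c
  have h1 : ∀ c', G c c' * (1 + d c') ≤ G c c' * (1 + ρ c c') * (1 + d c) := fun c' => by
    have h : 1 + d c' ≤ (1 + ρ c c') * (1 + d c) := by nlinarith [hd c, hρ c c', hdρ c c']
    calc G c c' * (1 + d c') ≤ G c c' * ((1 + ρ c c') * (1 + d c)) := mul_le_mul_of_nonneg_left h (hG c c')
      _ = G c c' * (1 + ρ c c') * (1 + d c) := by ring
  calc ∑ c', G c c' * (1 + d c') ≤ ∑ c', G c c' * (1 + ρ c c') * (1 + d c) := Finset.sum_le_sum fun c' _ => h1 c'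
    _ = (∑ c', G c c' * (1 + ρ c c')) * (1 + d c) := by rw [Finset.sum_mul]
    _ ≤ q * (1 + d c) := mul_le_mul_of_nonneg_right (hmom c) (by linarith [hd c])

end Aposteriori

/-! ## §1b The canonical leg distance is 1-Lipschitz in the periodic ℓ¹ distance of the sources -/

section LegLipschitz

variable {F : T3Family}

/-- Triangle inequality for the periodic ℓ¹ distance on a level (coordinatewise `pabs_add_le`). [folklore] -/
theorem pdist_triangle {K b : ℕ} (x y z : Site (F.P K) b) : pdist x z ≤ pdist x y + pdist y z := by
  unfold pdist
  rw [← Finset.sum_add_distrib]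
  refine Finset.sum_le_sum fun ν _ => ?_
  have h : x ν - z ν = (x ν - y ν) + (y ν - z ν) := by abel
  rw [h]
  exact_mod_cast B12Decay510Torus.pabs_add_le (x ν - y ν) (y ν - z ν)

/-- `pdist` is symmetric. [folklore] -/
theorem pdist_comm {K b : ℕ} (x z : Site (F.P K) b) : pdist x z = pdist z x := by
  unfold pdist
  exact Finset.sum_congr rfl fun ν _ => by rw [B12Decay510Torus.pabs_sub_comm]

/-- **THE CANONICAL LEG DISTANCE IS 1-LIPSCHITZ IN THE SOURCES**: `d(c′) ≤ d(c) + |c₋ − c′₋|_T` (the anchor attaining `d(c)` is a candidate for `c′`).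
[cite: Balaban1985UV3, (44) p.267] -/
theorem canonLegDist_le_add_pdist (K b : ℕ) (Y : Set (Site (F.P K) 0)) (c c' : PBond (F.P K) b) :
    canonLegDist F K b Y c' ≤ canonLegDist F K b Y c + pdist c.src c'.src := by
  obtain ⟨z, hz, hzeq⟩ := exists_canonLegDist_eq K b Y c
  calc canonLegDist F K b Y c' ≤ pdist c'.src z := canonLegDist_le c' hz
    _ ≤ pdist c'.src c.src + pdist c.src z := pdist_triangle _ _ _
    _ = canonLegDist F K b Y c + pdist c.src c'.src := by rw [hzeq, pdist_comm c'.src c.src, add_comm]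

/-- **DISPLAY (C) AT THE CANONICAL LEG DISTANCE FROM A KERNEL WITH A FIRST `ℓ¹`-MOMENT**: if `G ≥ 0` and `Σ_{c′} G(c,c′)·(1 + |c₋ − c′₋|_T) ≤ q` for every leg `c`, then
`Σ_{c′} G(c,c′)·(1 + d(c′)) ≤ q·(1 + d(c))` for `d = canonLegDist F K b Y` — the row-sum hypothesis of `weighted_lipschitz_of_kernel` with the weight `1 + d`.
[cite: Balaban1985UV3, (45) p.267] -/
theorem canon_rowsum_one_add_le (K b : ℕ) (Y : Set (Site (F.P K) 0)) (G : PBond (F.P K) b → PBond (F.P K) b → ℝ) (hG : ∀ c c', 0 ≤ G c c') {q : ℝ}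
    (hmom : ∀ c, ∑ c', G c c' * (1 + pdist c.src c'.src) ≤ q) :
    ∀ c, ∑ c', G c c' * (1 + canonLegDist F K b Y c') ≤ q * (1 + canonLegDist F K b Y c) :=
  kernel_rowsum_one_add_le (fun c => canonLegDist F K b Y c) (fun c => canonLegDist_nonneg F K b Y c) (fun c c' => pdist c.src c'.src)
    (fun _ _ => pdist_nonneg _ _) (fun c c' => canonLegDist_le_add_pdist K b Y c c') G hG hmom

end LegLipschitz

/-! ## §2 (R5) `CfgRefOwnΦ` for a fixed-point background from four single-run displays -/

section FixedPoint

variable {𝕍 : Type} [NormedAddCommGroup 𝕍] [NormedSpace ℂ 𝕍] {F : T3Family} {γ : ℝ}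

omit [NormedSpace ℂ 𝕍] in
/-- **(R5) FOR A FIXED-POINT BACKGROUND.**  Let `T K k b Y W` be run `K`'s defining map of the loop variables at `(k, b, Y, W)` (for the minimiser: [Balaban1985Variational]'s
successive-approximation map read in the `𝓗`-chart currency; here a FREE variable).  Suppose, on run `K`'s `θ(n)`-window and its listed domains `Y ∈ Loc K (K−n) triv (1+j)`:
(F) `B K (K−n) j Y (V↑)` is a fixed point of `T K (K−n) j Y (V↑)`; (C) `T K (K−n) j Y (V↑)` is legwise `(1+d)`-weighted `q`-Lipschitz on the (44)-ball
`{x | ∀ c, ‖x c‖ ≤ C_s·(1+d(c))·θ(n)·x²}`, with ONE rate `q < 1` for all `K, n, j, Y, V`; (S) `B` and `BR` lie in that ball — the (44) rows `CfgDistOwnΦ D B …`, `CfgDistOwnΦ D BR …`;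
(D) the reference has defect `‖T … (BR …) c − BR … c‖ ≤ C₀·(1+d(c))·θ(n)·x²·(L^{−(1+j)})^a`.  Then `CfgRefOwnΦ D B BR dist b₀ p₀ a (C₀/(1−q))` (distances nonnegative).
[cite: King1986, Prop. 3.9 (3.73)-(3.74) p.665; Balaban1985UV3, (44) p.267; Balaban1985Variational, Thm 1 (8) p.279] -/
theorem cfgRefOwnΦ_of_isFixedPt {D : AlphaDataT3 F γ} {B BR : CfgFam 𝕍 F} {dist : LegDist F} {b₀ p₀ a C_s q C₀ : ℝ}
    (T : (K k b : ℕ) → Set (Site (F.P K) 0) → GaugeField (F.P K) k (Matrix.specialUnitaryGroup (Fin 2) ℂ) → (PBond (F.P K) b → 𝕍) → (PBond (F.P K) b → 𝕍))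
    (hn : DistNonneg dist) (hq1 : q < 1)
    (hB : CfgDistOwnΦ D B dist b₀ p₀ C_s) (hBR : CfgDistOwnΦ D BR dist b₀ p₀ C_s)
    (hfix : ∀ (K n : ℕ) (h : n ≤ K), ∀ j : ℕ, j < K - n →
      ∀ V : GaugeField (F.P n) 0 (Matrix.specialUnitaryGroup (Fin 2) ℂ), PlaqSmall (θBal F.L γ b₀ p₀ n) V →
        ∀ Y ∈ D.Loc K (K - n) (D.triv K (K - n)) (1 + j),
          T K (K - n) j Y (fieldShift (F.sitesPerDir_eq (m := F.m) (K := K) (j := K - n) (m' := F.m) (K' := n) (j' := 0) (by omega)) V)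
              (B K (K - n) j Y (fieldShift (F.sitesPerDir_eq (m := F.m) (K := K) (j := K - n) (m' := F.m) (K' := n) (j' := 0) (by omega)) V)) =
            B K (K - n) j Y (fieldShift (F.sitesPerDir_eq (m := F.m) (K := K) (j := K - n) (m' := F.m) (K' := n) (j' := 0) (by omega)) V))
    (hlip : ∀ (K n : ℕ) (h : n ≤ K), ∀ j : ℕ, j < K - n →
      ∀ V : GaugeField (F.P n) 0 (Matrix.specialUnitaryGroup (Fin 2) ℂ), PlaqSmall (θBal F.L γ b₀ p₀ n) V →
        ∀ Y ∈ D.Loc K (K - n) (D.triv K (K - n)) (1 + j), ∀ x y : PBond (F.P K) j → 𝕍,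
          (∀ c, ‖x c‖ ≤ C_s * (1 + dist K j Y c) * θBal F.L γ b₀ p₀ n * (((F.L : ℝ) ^ (K - n - 1 - j))⁻¹) ^ 2) →
          (∀ c, ‖y c‖ ≤ C_s * (1 + dist K j Y c) * θBal F.L γ b₀ p₀ n * (((F.L : ℝ) ^ (K - n - 1 - j))⁻¹) ^ 2) →
            ∀ M : ℝ, 0 ≤ M → (∀ c, ‖x c - y c‖ ≤ M * (1 + dist K j Y c)) →
              ∀ c, ‖T K (K - n) j Y (fieldShift (F.sitesPerDir_eq (m := F.m) (K := K) (j := K - n) (m' := F.m) (K' := n) (j' := 0) (by omega)) V) x c -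
                  T K (K - n) j Y (fieldShift (F.sitesPerDir_eq (m := F.m) (K := K) (j := K - n) (m' := F.m) (K' := n) (j' := 0) (by omega)) V) y c‖ ≤
                q * M * (1 + dist K j Y c))
    (hdef : ∀ (K n : ℕ) (h : n ≤ K), ∀ j : ℕ, j < K - n →
      ∀ V : GaugeField (F.P n) 0 (Matrix.specialUnitaryGroup (Fin 2) ℂ), PlaqSmall (θBal F.L γ b₀ p₀ n) V →
        ∀ Y ∈ D.Loc K (K - n) (D.triv K (K - n)) (1 + j), ∀ c : PBond (F.P K) j,
          ‖T K (K - n) j Y (fieldShift (F.sitesPerDir_eq (m := F.m) (K := K) (j := K - n) (m' := F.m) (K' := n) (j' := 0) (by omega)) V)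
                (BR K (K - n) j Y (fieldShift (F.sitesPerDir_eq (m := F.m) (K := K) (j := K - n) (m' := F.m) (K' := n) (j' := 0) (by omega)) V)) c -
              BR K (K - n) j Y (fieldShift (F.sitesPerDir_eq (m := F.m) (K := K) (j := K - n) (m' := F.m) (K' := n) (j' := 0) (by omega)) V) c‖ ≤
            C₀ * (1 + dist K j Y c) * θBal F.L γ b₀ p₀ n * (((F.L : ℝ) ^ (K - n - 1 - j))⁻¹) ^ 2 * (((F.L : ℝ) ^ (1 + j))⁻¹) ^ a) :
    CfgRefOwnΦ D B BR dist b₀ p₀ a (C₀ / (1 - q)) := by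
  intro K n hnK j hj V hV Y hY
  -- abbreviations: the shifted field, the two configurations, the budget per unit weight
  set W := fieldShift (F.sitesPerDir_eq (m := F.m) (K := K) (j := K - n) (m' := F.m) (K' := n) (j' := 0) (by omega)) V with hW
  set x : PBond (F.P K) j → 𝕍 := B K (K - n) j Y W with hx
  set y : PBond (F.P K) j → 𝕍 := BR K (K - n) j Y W with hy
  set δ : ℝ := C₀ * θBal F.L γ b₀ p₀ n * (((F.L : ℝ) ^ (K - n - 1 - j))⁻¹) ^ 2 * (((F.L : ℝ) ^ (1 + j))⁻¹) ^ a with hδ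
  have hw : ∀ c : PBond (F.P K) j, 0 < 1 + dist K j Y c := fun c => by linarith [hn K j Y c]
  have hxball := hB K n hnK j hj V hV Y hY
  have hyball := hBR K n hnK j hj V hV Y hY
  have key := norm_sub_le_weighted_of_isFixedPt (fun c => 1 + dist K j Y c) hw (T K (K - n) j Y W) hq1 x y
    (hfix K n hnK j hj V hV Y hY)
    (fun M hM hxy => hlip K n hnK j hj V hV Y hY x y hxball hyball M hM hxy)
    (fun c => (hdef K n hnK j hj V hV Y hY c).trans_eq (show _ = δ * (1 + dist K j Y c) by rw [hδ]; ring))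
  intro c
  calc ‖x c - y c‖ ≤ δ / (1 - q) * (1 + dist K j Y c) := key c
    _ = C₀ / (1 - q) * (1 + dist K j Y c) * θBal F.L γ b₀ p₀ n * (((F.L : ℝ) ^ (K - n - 1 - j))⁻¹) ^ 2 * (((F.L : ℝ) ^ (1 + j))⁻¹) ^ a := by
        rw [hδ]; ring

omit [NormedSpace ℂ 𝕍] in
/-- **(R5) FOR A FIXED-POINT BACKGROUND, THE DEFECT SPLIT [King1986]-STYLE**: as `cfgRefOwnΦ_of_isFixedPt`, with (D) replaced by (R) «`BR` solves the REFERENCE equation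
`T∞ K (K−n) j Y (V↑) (BR …) = BR …`» and (M) «the two maps differ at `BR` by the budget»: `‖T … (BR …) c − T∞ … (BR …) c‖ ≤ C₀·(1+d(c))·θ(n)·x²·(L^{−(1+j)})^a` — the two-cut-off
difference of the defining maps at ONE bounded configuration (for the minimiser: the I-11 propagator two-cut-off row applied to `BR`'s data, [King1986] (3.74)).
[cite: King1986, Prop. 3.9 (3.73)-(3.74) p.665; Balaban1985Variational, Thm 1 (8) p.279] -/
theorem cfgRefOwnΦ_of_isFixedPt_pair {D : AlphaDataT3 F γ} {B BR : CfgFam 𝕍 F} {dist : LegDist F} {b₀ p₀ a C_s q C₀ : ℝ}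
    (T Tinf : (K k b : ℕ) → Set (Site (F.P K) 0) → GaugeField (F.P K) k (Matrix.specialUnitaryGroup (Fin 2) ℂ) → (PBond (F.P K) b → 𝕍) → (PBond (F.P K) b → 𝕍))
    (hn : DistNonneg dist) (hq1 : q < 1)
    (hB : CfgDistOwnΦ D B dist b₀ p₀ C_s) (hBR : CfgDistOwnΦ D BR dist b₀ p₀ C_s)
    (hfix : ∀ (K n : ℕ) (h : n ≤ K), ∀ j : ℕ, j < K - n →
      ∀ V : GaugeField (F.P n) 0 (Matrix.specialUnitaryGroup (Fin 2) ℂ), PlaqSmall (θBal F.L γ b₀ p₀ n) V →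
        ∀ Y ∈ D.Loc K (K - n) (D.triv K (K - n)) (1 + j),
          T K (K - n) j Y (fieldShift (F.sitesPerDir_eq (m := F.m) (K := K) (j := K - n) (m' := F.m) (K' := n) (j' := 0) (by omega)) V)
              (B K (K - n) j Y (fieldShift (F.sitesPerDir_eq (m := F.m) (K := K) (j := K - n) (m' := F.m) (K' := n) (j' := 0) (by omega)) V)) =
            B K (K - n) j Y (fieldShift (F.sitesPerDir_eq (m := F.m) (K := K) (j := K - n) (m' := F.m) (K' := n) (j' := 0) (by omega)) V))
    (hfixR : ∀ (K n : ℕ) (h : n ≤ K), ∀ j : ℕ, j < K - n →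
      ∀ V : GaugeField (F.P n) 0 (Matrix.specialUnitaryGroup (Fin 2) ℂ), PlaqSmall (θBal F.L γ b₀ p₀ n) V →
        ∀ Y ∈ D.Loc K (K - n) (D.triv K (K - n)) (1 + j),
          Tinf K (K - n) j Y (fieldShift (F.sitesPerDir_eq (m := F.m) (K := K) (j := K - n) (m' := F.m) (K' := n) (j' := 0) (by omega)) V)
              (BR K (K - n) j Y (fieldShift (F.sitesPerDir_eq (m := F.m) (K := K) (j := K - n) (m' := F.m) (K' := n) (j' := 0) (by omega)) V)) =
            BR K (K - n) j Y (fieldShift (F.sitesPerDir_eq (m := F.m) (K := K) (j := K - n) (m' := F.m) (K' := n) (j' := 0) (by omega)) V))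
    (hlip : ∀ (K n : ℕ) (h : n ≤ K), ∀ j : ℕ, j < K - n →
      ∀ V : GaugeField (F.P n) 0 (Matrix.specialUnitaryGroup (Fin 2) ℂ), PlaqSmall (θBal F.L γ b₀ p₀ n) V →
        ∀ Y ∈ D.Loc K (K - n) (D.triv K (K - n)) (1 + j), ∀ x y : PBond (F.P K) j → 𝕍,
          (∀ c, ‖x c‖ ≤ C_s * (1 + dist K j Y c) * θBal F.L γ b₀ p₀ n * (((F.L : ℝ) ^ (K - n - 1 - j))⁻¹) ^ 2) →
          (∀ c, ‖y c‖ ≤ C_s * (1 + dist K j Y c) * θBal F.L γ b₀ p₀ n * (((F.L : ℝ) ^ (K - n - 1 - j))⁻¹) ^ 2) →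
            ∀ M : ℝ, 0 ≤ M → (∀ c, ‖x c - y c‖ ≤ M * (1 + dist K j Y c)) →
              ∀ c, ‖T K (K - n) j Y (fieldShift (F.sitesPerDir_eq (m := F.m) (K := K) (j := K - n) (m' := F.m) (K' := n) (j' := 0) (by omega)) V) x c -
                  T K (K - n) j Y (fieldShift (F.sitesPerDir_eq (m := F.m) (K := K) (j := K - n) (m' := F.m) (K' := n) (j' := 0) (by omega)) V) y c‖ ≤
                q * M * (1 + dist K j Y c))
    (hmap : ∀ (K n : ℕ) (h : n ≤ K), ∀ j : ℕ, j < K - n →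
      ∀ V : GaugeField (F.P n) 0 (Matrix.specialUnitaryGroup (Fin 2) ℂ), PlaqSmall (θBal F.L γ b₀ p₀ n) V →
        ∀ Y ∈ D.Loc K (K - n) (D.triv K (K - n)) (1 + j), ∀ c : PBond (F.P K) j,
          ‖T K (K - n) j Y (fieldShift (F.sitesPerDir_eq (m := F.m) (K := K) (j := K - n) (m' := F.m) (K' := n) (j' := 0) (by omega)) V)
                (BR K (K - n) j Y (fieldShift (F.sitesPerDir_eq (m := F.m) (K := K) (j := K - n) (m' := F.m) (K' := n) (j' := 0) (by omega)) V)) c -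
              Tinf K (K - n) j Y (fieldShift (F.sitesPerDir_eq (m := F.m) (K := K) (j := K - n) (m' := F.m) (K' := n) (j' := 0) (by omega)) V)
                (BR K (K - n) j Y (fieldShift (F.sitesPerDir_eq (m := F.m) (K := K) (j := K - n) (m' := F.m) (K' := n) (j' := 0) (by omega)) V)) c‖ ≤
            C₀ * (1 + dist K j Y c) * θBal F.L γ b₀ p₀ n * (((F.L : ℝ) ^ (K - n - 1 - j))⁻¹) ^ 2 * (((F.L : ℝ) ^ (1 + j))⁻¹) ^ a) :
    CfgRefOwnΦ D B BR dist b₀ p₀ a (C₀ / (1 - q)) :=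
  cfgRefOwnΦ_of_isFixedPt T hn hq1 hB hBR hfix hlip fun K n hnK j hj V hV Y hY c => by
    have h := hmap K n hnK j hj V hV Y hY c
    rwa [hfixR K n hnK j hj V hV Y hY] at h

end FixedPoint

/-! ## §3 The rows of record and the χ-instances at a free profile, by name -/

section Record

variable {𝕍 : Type} [NormedAddCommGroup 𝕍] [NormedSpace ℂ 𝕍] {F : T3Family} {γ : ℝ}

omit [NormedSpace ℂ 𝕍] in
/-- **THE PER-RUN ROW OF RECORD `CfgRefΦ` FOR A FIXED-POINT BACKGROUND** (`cfgRefΦ_of_own ∘ cfgRefOwnΦ_of_isFixedPt`; the geometry letters `LocMatched`, matched nonnegative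
distances, the window letters `1 ≤ L`, `0 < γ ≤ 1`, `0 < b₀`, and `0 ≤ C₀`, `0 ≤ a`). [cite: King1986, Prop. 3.9 (3.71)-(3.74) p.665] -/
theorem cfgRefΦ_of_isFixedPt {D : AlphaDataT3 F γ} {B BR : CfgFam 𝕍 F} {dist : LegDist F} {b₀ p₀ a C_s q C₀ : ℝ}
    (T : (K k b : ℕ) → Set (Site (F.P K) 0) → GaugeField (F.P K) k (Matrix.specialUnitaryGroup (Fin 2) ℂ) → (PBond (F.P K) b → 𝕍) → (PBond (F.P K) b → 𝕍))
    (hLoc : LocMatched D) (hm : DistMatched dist) (hn : DistNonneg dist) (hL : 1 ≤ F.L) (hγ : 0 < γ) (hγ1 : γ ≤ 1) (hb : 0 < b₀)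
    (hq1 : q < 1) (hC₀ : 0 ≤ C₀) (ha : 0 ≤ a)
    (hB : CfgDistOwnΦ D B dist b₀ p₀ C_s) (hBR : CfgDistOwnΦ D BR dist b₀ p₀ C_s)
    (hfix : ∀ (K n : ℕ) (h : n ≤ K), ∀ j : ℕ, j < K - n →
      ∀ V : GaugeField (F.P n) 0 (Matrix.specialUnitaryGroup (Fin 2) ℂ), PlaqSmall (θBal F.L γ b₀ p₀ n) V →
        ∀ Y ∈ D.Loc K (K - n) (D.triv K (K - n)) (1 + j),
          T K (K - n) j Y (fieldShift (F.sitesPerDir_eq (m := F.m) (K := K) (j := K - n) (m' := F.m) (K' := n) (j' := 0) (by omega)) V)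
              (B K (K - n) j Y (fieldShift (F.sitesPerDir_eq (m := F.m) (K := K) (j := K - n) (m' := F.m) (K' := n) (j' := 0) (by omega)) V)) =
            B K (K - n) j Y (fieldShift (F.sitesPerDir_eq (m := F.m) (K := K) (j := K - n) (m' := F.m) (K' := n) (j' := 0) (by omega)) V))
    (hlip : ∀ (K n : ℕ) (h : n ≤ K), ∀ j : ℕ, j < K - n →
      ∀ V : GaugeField (F.P n) 0 (Matrix.specialUnitaryGroup (Fin 2) ℂ), PlaqSmall (θBal F.L γ b₀ p₀ n) V →
        ∀ Y ∈ D.Loc K (K - n) (D.triv K (K - n)) (1 + j), ∀ x y : PBond (F.P K) j → 𝕍,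
          (∀ c, ‖x c‖ ≤ C_s * (1 + dist K j Y c) * θBal F.L γ b₀ p₀ n * (((F.L : ℝ) ^ (K - n - 1 - j))⁻¹) ^ 2) →
          (∀ c, ‖y c‖ ≤ C_s * (1 + dist K j Y c) * θBal F.L γ b₀ p₀ n * (((F.L : ℝ) ^ (K - n - 1 - j))⁻¹) ^ 2) →
            ∀ M : ℝ, 0 ≤ M → (∀ c, ‖x c - y c‖ ≤ M * (1 + dist K j Y c)) →
              ∀ c, ‖T K (K - n) j Y (fieldShift (F.sitesPerDir_eq (m := F.m) (K := K) (j := K - n) (m' := F.m) (K' := n) (j' := 0) (by omega)) V) x c -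
                  T K (K - n) j Y (fieldShift (F.sitesPerDir_eq (m := F.m) (K := K) (j := K - n) (m' := F.m) (K' := n) (j' := 0) (by omega)) V) y c‖ ≤
                q * M * (1 + dist K j Y c))
    (hdef : ∀ (K n : ℕ) (h : n ≤ K), ∀ j : ℕ, j < K - n →
      ∀ V : GaugeField (F.P n) 0 (Matrix.specialUnitaryGroup (Fin 2) ℂ), PlaqSmall (θBal F.L γ b₀ p₀ n) V →
        ∀ Y ∈ D.Loc K (K - n) (D.triv K (K - n)) (1 + j), ∀ c : PBond (F.P K) j,
          ‖T K (K - n) j Y (fieldShift (F.sitesPerDir_eq (m := F.m) (K := K) (j := K - n) (m' := F.m) (K' := n) (j' := 0) (by omega)) V)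
                (BR K (K - n) j Y (fieldShift (F.sitesPerDir_eq (m := F.m) (K := K) (j := K - n) (m' := F.m) (K' := n) (j' := 0) (by omega)) V)) c -
              BR K (K - n) j Y (fieldShift (F.sitesPerDir_eq (m := F.m) (K := K) (j := K - n) (m' := F.m) (K' := n) (j' := 0) (by omega)) V) c‖ ≤
            C₀ * (1 + dist K j Y c) * θBal F.L γ b₀ p₀ n * (((F.L : ℝ) ^ (K - n - 1 - j))⁻¹) ^ 2 * (((F.L : ℝ) ^ (1 + j))⁻¹) ^ a) :
    CfgRefΦ D B BR dist b₀ p₀ a (C₀ / (1 - q)) :=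
  cfgRefΦ_of_own hLoc hm hn hL hγ hγ1 hb (div_nonneg hC₀ (by linarith)) ha (cfgRefOwnΦ_of_isFixedPt T hn hq1 hB hBR hfix hlip hdef)

omit [NormedSpace ℂ 𝕍] in
/-- **THE I-11 ROW `CfgDistCauchyΦ` FOR A FIXED-POINT BACKGROUND WITH A COHERENT REFERENCE** (`cfgDistCauchyΦ_of_ref ∘ cfgRefΦ_of_isFixedPt`; constant `2·C₀/(1−q)`): the
two-run loop-variable Cauchy row of 3⁗χ from (F) fixed point, (C) `K`-uniform leg-weighted contraction on the (44)-ball, (S) the (44) rows for `B` and `BR`, (D) the defect of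
the coherent reference `BR` in each run's equation — plus the geometry / window letters. [cite: King1986, Prop. 3.9 (3.71)-(3.74) p.665, Prop. 3.10 (3.91) p.669; Balaban1985UV3, (44) p.267] -/
theorem cfgDistCauchyΦ_of_isFixedPt {D : AlphaDataT3 F γ} {B BR : CfgFam 𝕍 F} {dist : LegDist F} {b₀ p₀ a C_s q C₀ : ℝ}
    (T : (K k b : ℕ) → Set (Site (F.P K) 0) → GaugeField (F.P K) k (Matrix.specialUnitaryGroup (Fin 2) ℂ) → (PBond (F.P K) b → 𝕍) → (PBond (F.P K) b → 𝕍))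
    (hcoh : RefCfgCoherent BR) (hLoc : LocMatched D) (hm : DistMatched dist) (hn : DistNonneg dist) (hL : 1 ≤ F.L) (hγ : 0 < γ) (hγ1 : γ ≤ 1) (hb : 0 < b₀)
    (hq1 : q < 1) (hC₀ : 0 ≤ C₀) (ha : 0 ≤ a)
    (hB : CfgDistOwnΦ D B dist b₀ p₀ C_s) (hBR : CfgDistOwnΦ D BR dist b₀ p₀ C_s)
    (hfix : ∀ (K n : ℕ) (h : n ≤ K), ∀ j : ℕ, j < K - n →
      ∀ V : GaugeField (F.P n) 0 (Matrix.specialUnitaryGroup (Fin 2) ℂ), PlaqSmall (θBal F.L γ b₀ p₀ n) V →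
        ∀ Y ∈ D.Loc K (K - n) (D.triv K (K - n)) (1 + j),
          T K (K - n) j Y (fieldShift (F.sitesPerDir_eq (m := F.m) (K := K) (j := K - n) (m' := F.m) (K' := n) (j' := 0) (by omega)) V)
              (B K (K - n) j Y (fieldShift (F.sitesPerDir_eq (m := F.m) (K := K) (j := K - n) (m' := F.m) (K' := n) (j' := 0) (by omega)) V)) =
            B K (K - n) j Y (fieldShift (F.sitesPerDir_eq (m := F.m) (K := K) (j := K - n) (m' := F.m) (K' := n) (j' := 0) (by omega)) V))
    (hlip : ∀ (K n : ℕ) (h : n ≤ K), ∀ j : ℕ, j < K - n →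
      ∀ V : GaugeField (F.P n) 0 (Matrix.specialUnitaryGroup (Fin 2) ℂ), PlaqSmall (θBal F.L γ b₀ p₀ n) V →
        ∀ Y ∈ D.Loc K (K - n) (D.triv K (K - n)) (1 + j), ∀ x y : PBond (F.P K) j → 𝕍,
          (∀ c, ‖x c‖ ≤ C_s * (1 + dist K j Y c) * θBal F.L γ b₀ p₀ n * (((F.L : ℝ) ^ (K - n - 1 - j))⁻¹) ^ 2) →
          (∀ c, ‖y c‖ ≤ C_s * (1 + dist K j Y c) * θBal F.L γ b₀ p₀ n * (((F.L : ℝ) ^ (K - n - 1 - j))⁻¹) ^ 2) →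
            ∀ M : ℝ, 0 ≤ M → (∀ c, ‖x c - y c‖ ≤ M * (1 + dist K j Y c)) →
              ∀ c, ‖T K (K - n) j Y (fieldShift (F.sitesPerDir_eq (m := F.m) (K := K) (j := K - n) (m' := F.m) (K' := n) (j' := 0) (by omega)) V) x c -
                  T K (K - n) j Y (fieldShift (F.sitesPerDir_eq (m := F.m) (K := K) (j := K - n) (m' := F.m) (K' := n) (j' := 0) (by omega)) V) y c‖ ≤
                q * M * (1 + dist K j Y c))
    (hdef : ∀ (K n : ℕ) (h : n ≤ K), ∀ j : ℕ, j < K - n →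
      ∀ V : GaugeField (F.P n) 0 (Matrix.specialUnitaryGroup (Fin 2) ℂ), PlaqSmall (θBal F.L γ b₀ p₀ n) V →
        ∀ Y ∈ D.Loc K (K - n) (D.triv K (K - n)) (1 + j), ∀ c : PBond (F.P K) j,
          ‖T K (K - n) j Y (fieldShift (F.sitesPerDir_eq (m := F.m) (K := K) (j := K - n) (m' := F.m) (K' := n) (j' := 0) (by omega)) V)
                (BR K (K - n) j Y (fieldShift (F.sitesPerDir_eq (m := F.m) (K := K) (j := K - n) (m' := F.m) (K' := n) (j' := 0) (by omega)) V)) c -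
              BR K (K - n) j Y (fieldShift (F.sitesPerDir_eq (m := F.m) (K := K) (j := K - n) (m' := F.m) (K' := n) (j' := 0) (by omega)) V) c‖ ≤
            C₀ * (1 + dist K j Y c) * θBal F.L γ b₀ p₀ n * (((F.L : ℝ) ^ (K - n - 1 - j))⁻¹) ^ 2 * (((F.L : ℝ) ^ (1 + j))⁻¹) ^ a) :
    CfgDistCauchyΦ D B dist b₀ p₀ a (2 * (C₀ / (1 - q))) :=
  cfgDistCauchyΦ_of_ref hcoh (cfgRefΦ_of_isFixedPt T hLoc hm hn hL hγ hγ1 hb hq1 hC₀ ha hB hBR hfix hlip hdef)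

end Record

end Summit.QuantumFields.YangMills.Theorems.GlobalSlackKernelLeg

end
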